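import Mathlib
import Literature.Analysis.FluidPDE.SelfSimilar
import Literature.Analysis.FluidPDE.SelfSimilarLiouville
import Literature.Analysis.FluidPDE.AxisymmetricEuler
import Literature.Analysis.FluidPDE.KNSSAxisymmetricNoSwirlHolds
import Summits.NavierStokesRegularity.NavierStokesRegularity.Theorems.UnthreadedDoorNetFluxNSSpatialAnalyticity
import Summits.NavierStokesRegularity.NavierStokesRegularity.Theorems.ThreadingFluxSilentShellsTwoAxesTools
import Summits.NavierStokesRegularity.NavierStokesRegularity.Theorems.ThreadingFluxSilentShellsAxisPinning
import Summits.NavierStokesRegularity.NavierStokesRegularity.Theorems.ThreadingFluxSilentShellsGalileanPropagation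
import HarnessLib

/-!
# Crux `PoloidalLiouville` (stmt-NavierStokesRegularity-1222, W1), crux idea «silent-shells» (ns-idea-15):
# the local-axis trigger `LocalAxisTrigger0` — UNCONDITIONAL

The sketch `Cruxes/PoloidalLiouville/SilentShellsSketch.lean` (v1.4, l.563) types the NS-side target of the card as

`LocalAxisTrigger0 : ∀ v, IsBoundedAncientMildSolution 1 v → (∀ t < 0, AEStronglyMeasurable (v t) volume) →
   ContDiffOn ℝ ⊤ (uncurry v) (Iio 0 ×ˢ univ) → (∀ t < 0, ∀ x, ⟪x, curl (v t) x⟫ = 0) →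
   (∃ t₁ < 0, ∃ S, IsOpen S ∧ S.Nonempty ∧ ∀ θ, ∀ x ∈ S, v t₁ (rotZ θ x) = rotZ θ (v t₁ x)) → ∀ t < 0, ∃ b, ∀ x, v t x = b`

— W1's class (bounded ancient mild, smooth, UNTHREADED about the centre `0`) with ONE extra hypothesis: some slice is
axisymmetric about the `e_z`-axis on some non-empty open set; conclusion: every slice is constant.  The sketch reduces it by
kernel glue (`localAxisTrigger0_of_gauge'`, v1.4) to I1′ `SliceAnalytic'` + I2″ `GalileanAxisymmetryPropagates` + tree facts.
ALL inputs are now tree theorems, so this file lands the trigger itself, body VERBATIM (`localAxisTrigger0`), porting the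
sketch's glue over the landed names:

* I1′ = HH-0 `NetFlux.nsSpatialAnalyticity` (p682567): slices are real-analytic, so local axisymmetry on an open set is
  global (`SilentShells.isAxisymmetric_of_locallyAxisymmetric`, p696448's tools file — O3);
* I2″ `SilentShells.galileanAxisymmetryPropagates` (this lineage): after a Galilean change of gauge
  `ṽ t x = v t (x + A t) − c t` that stays in the class, EVERY slice is axisymmetric;
* unthreadedness of `v` about `0` = tangency of `curl ṽ(s)` to the spheres about `−A s` (`curl` commutes with
  translations and kills constants); axis pinning Z (`SilentShells.axisPinning_dichotomy`, p696701): `A s` is ON THE AXIS or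
  `ṽ s` is irrotational; either way I3 (`SilentShells.hasNoSwirl_of_isAxisymmetric_of_unthreaded_axisPoint`, p696701) gives
  NO SWIRL;
* KNSS 2009 Thm 5.2 for bounded ancient mild axisymmetric no-swirl solutions (tree fact, PROVED:
  `knss_axisymmetric_no_swirl'_holds`): every slice of `ṽ` is a.e. constant, hence constant (continuity), hence so is
  every slice of `v`.

READING: a hypothetical W1 counterexample is NOWHERE locally axisymmetric about any axis through its centre, at any time
(centre `0` and axis `e_z` are WLOG by the Euclidean covariance of the class).  This is a statement about the SHAPE of
hypothetical objects; `PoloidalLiouville` (1222) itself, W1 and NS regularity stay OPEN / NOT proved.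
`--supports stmt-NavierStokesRegularity-1222 --as helper`; 0 kit.  [folklore]
-/

-- the summit and its single problem share the name (D-0017 nested layout)
set_option linter.dupNamespace false

noncomputable section

open Set Function Filter Topology Metric MeasureTheory
open scoped Topology ENNReal RealInnerProductSpace
open Literature.Analysis Literature.Analysis.FluidPDE

namespace Summit.NavierStokesRegularity.NavierStokesRegularity.Theorems.PoloidalLiouville.SilentShells

open Summit.NavierStokesRegularity.NavierStokesRegularity.Theorems
open Summit.NavierStokesRegularity.NavierStokesRegularity.Theorems.PoloidalLiouville.NetFlux (E3)

namespace LocalAxisTrigger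

/-- Slices of a jointly smooth `v` are `C¹` (sketch `slice_contDiff_two`, the exponent we need). [folklore] -/
theorem slice_contDiff_one {v : ℝ → E3 → E3}
    (hv : ContDiffOn ℝ (⊤ : ℕ∞) (Function.uncurry v) (Set.Iio 0 ×ˢ Set.univ)) {t : ℝ} (ht : t < 0) :
    ContDiff ℝ 1 (v t) := by
  have hg : ContDiff ℝ (⊤ : ℕ∞) (fun x : E3 => ((t, x) : ℝ × E3)) := contDiff_const.prodMk contDiff_id
  have h : ContDiffOn ℝ (⊤ : ℕ∞) (Function.uncurry v ∘ fun x : E3 => ((t, x) : ℝ × E3)) univ :=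
    hv.comp hg.contDiffOn (fun x _ => Set.mk_mem_prod ht (Set.mem_univ x))
  have h' : ContDiff ℝ (⊤ : ℕ∞) (v t) := by
    rw [← contDiffOn_univ]
    exact h
  exact h'.of_le (by exact_mod_cast le_top)

/-- The curl of a Galilean translate: `curl (V(· + a) − c) (y) = curl V (y + a)` (sketch `curl_translate_sub_const`). [folklore] -/
theorem curl_translate_sub_const (V : E3 → E3) (a c y : E3) :
    curl (fun x => V (x + a) - c) y = curl V (y + a) := by
  simp only [curl, fderiv_sub_const, fderiv_comp_add_right]

end LocalAxisTrigger

open LocalAxisTrigger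

/-- **`LocalAxisTrigger0` — UNCONDITIONAL** (silent-shells sketch v1.4 l.563, body verbatim; the sketch's kernel glue
`localAxisTrigger0_of_gauge'` ported over the landed inputs I1′ = HH-0 `NetFlux.nsSpatialAnalyticity`, I2″
`SilentShells.galileanAxisymmetryPropagates`, O3 `SilentShells.isAxisymmetric_of_locallyAxisymmetric`, Z
`SilentShells.axisPinning_dichotomy`, I3 `SilentShells.hasNoSwirl_of_isAxisymmetric_of_unthreaded_axisPoint` and KNSS 2009
Thm 5.2 `knss_axisymmetric_no_swirl'_holds`).  In W1's class (bounded ancient mild, a.e.-measurable slices, smooth on the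
open past slab, unthreaded about `0`), ONE slice axisymmetric about the `e_z`-axis on ONE non-empty open set forces EVERY
slice to be constant. [folklore] -/
theorem localAxisTrigger0 :
    ∀ v : ℝ → E3 → E3, IsBoundedAncientMildSolution 1 v →
      (∀ t < 0, AEStronglyMeasurable (v t) volume) →
      ContDiffOn ℝ (⊤ : ℕ∞) (Function.uncurry v) (Set.Iio 0 ×ˢ Set.univ) →
      (∀ t < 0, ∀ x, ⟪x, curl (v t) x⟫ = 0) →
      (∃ t₁ < 0, ∃ S : Set E3, IsOpen S ∧ S.Nonempty ∧
          ∀ θ : ℝ, ∀ x ∈ S, v t₁ (rotZ θ x) = rotZ θ (v t₁ x)) →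
      ∀ t < 0, ∃ b : E3, ∀ x, v t x = b := by
  intro v hv hmeas hsm hunthr htrig t ht
  obtain ⟨t₁, ht₁, S, hS, hne, hloc⟩ := htrig
  -- (1) the locally symmetric slice is globally axisymmetric (I1′ = HH-0 + O3)
  have hax₁ : IsAxisymmetric (v t₁) :=
    isAxisymmetric_of_locallyAxisymmetric (NetFlux.nsSpatialAnalyticity v hv hmeas hsm t₁ ht₁) hS hne hloc
  -- (2) gauge-fix: every slice of `ṽ` is axisymmetric (I2″)
  obtain ⟨A, c, hgv, hgmeas, hgax⟩ := galileanAxisymmetryPropagates v hv hmeas hsm ⟨t₁, ht₁, hax₁⟩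
  -- slices of `ṽ` are `C¹`
  have hgC1 : ∀ s < 0, ContDiff ℝ 1 (fun x => v s (x + A s) - c s) := fun s hs =>
    ((slice_contDiff_one hsm hs).comp (contDiff_id.add contDiff_const)).sub contDiff_const
  -- (3) tangency of `curl ṽ(s)` to the spheres about `−A(s)` (unthreadedness of `v` about `0`)
  have htan : ∀ s < 0, ∀ y, ⟪y + A s, curl (fun x => v s (x + A s) - c s) y⟫ = 0 := by
    intro s hs y
    rw [curl_translate_sub_const]
    exact hunthr s hs (y + A s)
  -- (4) every slice of `ṽ` is swirl-free: axis pinning (Z) + I3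
  have hsw : ∀ s < 0, HasNoSwirl (fun x => v s (x + A s) - c s) := by
    intro s hs
    rcases axisPinning_dichotomy (hgax s hs) (hgC1 s hs) (A s) (htan s hs) with hA | hzero
    · exact hasNoSwirl_of_isAxisymmetric_of_unthreaded_axisPoint (hgax s hs) (hgC1 s hs) hA (htan s hs)
    · refine hasNoSwirl_of_isAxisymmetric_of_unthreaded_axisPoint (hgax s hs) (hgC1 s hs)
        (a := (0 : E3)) ⟨rfl, rfl⟩ fun y => ?_
      rw [hzero y, inner_zero_right]
  -- (5) KNSS 2009 Thm 5.2 (tree) on `ṽ`: the slice is a.e. constant, hence constant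
  obtain ⟨b, hb⟩ := knss_axisymmetric_no_swirl'_holds hgv hgmeas hgax hsw t ht
  have hcont : Continuous (fun x => v t (x + A t) - c t) := (hgC1 t ht).continuous
  have heq : (fun x => v t (x + A t) - c t) = fun _ => b :=
    (Continuous.ae_eq_iff_eq volume hcont continuous_const).1 hb
  refine ⟨b + c t, fun x => ?_⟩
  have hx := congrFun heq (x - A t)
  simp only [sub_add_cancel] at hx
  rw [← hx, sub_add_cancel]

end Summit.NavierStokesRegularity.NavierStokesRegularity.Theorems.PoloidalLiouville.SilentShells
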